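import Summits.AtomisticToContinuum.Crystallization.Theorems.FreeSplittingCertificatesStrictSplittingRuleP1FarSitePointwise

/-!
# `StrictSplittingRule` (stmt-AtomisticToContinuum-12560): the (S) tail lemma, II — the CREDIT and RADIAL far shares of a far site INTEGRATED over its star (P1 interpolant object, part 82)

Route `FreeSplittingCertificates`, crux r3 `StrictSplittingRule` (H12⋆ = `stub_coreJointCoercive`), unit b2b-freesplit-B gen 36.
VALUE = kernel bricks for the (S) TAIL LEMMA (HOME FAR-LEMMA-SPEC §20 (c)/(e)(3); assembled in part 83).  For `‖y_q − y_p‖ = r ≥ 20a` on the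
`HcpFamilyMin` box (only `h² ≤ 5a²/6` is used), `V = √3a²h/2`, `τ = (2/9)a² + h²/6`, `σ' = (1/8 + √3/36 + 7/72)a² + h²/6`, `P = ⟨y_q − y_p, z⟩`:
* **`credStar_le`** — `Bare_cred,q(z) ≤ κ(3/16)|z|²r⁻⁸·[V + (2/3)a³h/r + 10a²V/r² + 18(6ar + 9a²/4)Vτ/r⁴]`;
* **`radStar_ge`** — `Bare_rad,q(z) ≥ κ(19/8)r⁻¹⁰·[P²V − (135/4)(a³/r)|z|²V − (a³h/6)|P||z| − (5/6)(a³h/r)P² − 20Vσ'|P||z|/r − 5VτP²/r²]`.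
Proof = `p1SiteBare_const_eq_star` + the pointwise bounds of part 81 on every star cell (star radius, `χ ≡ 1` / `χ² ≤ 1`) + monotonicity and
the polynomial star integral of part 80 + the moment bounds of part 81.  NOT a proof of H12⋆, NOT summit progress.  [folklore]
-/

noncomputable section

open Set Function Metric MeasureTheory Filter Topology
open scoped BigOperators NNReal ENNReal Classical

namespace Summit.AtomisticToContinuum.Crystallization.Theorems.StrictSplittingRuleBirth

open Literature.MathematicalPhysics.StatisticalMechanics
open Summit.AtomisticToContinuum.Crystallization.Theorems.PalmUnimodularRigidity.LayeredLawsSelectHcp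

/-! ## The credit share of a far site, integrated over its star -/

/-- **CREDIT SHARE OF A FAR SITE (upper bound)**: for `‖y_q − y_p‖ = r ≥ 20a` (and `h² ≤ 5a²/6`),
`Bare_cred,q(z) ≤ κ(3/16)|z|²r⁻⁸·[V + (2/3)a³h/r + 10a²V/r² + 18(6ar + 9a²/4)Vτ/r⁴]`, `V = √3a²h/2`, `τ = (2/9)a² + h²/6`.
NOT a proof of H12⋆, NOT summit progress. -/
theorem credStar_le {a h : ℝ} (ha : 0 < a) (hh : 0 < h) (hha : h ^ 2 ≤ 5 / 6 * a ^ 2) (p q : ℤ × ℤ × ℤ) {r : ℝ}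
    (hr : 20 * a ≤ r) (hd : fpSq (fun k => hcpSite a h q k - hcpSite a h p k) = r ^ 2) (z : Fin 3 → ℝ) :
    p1SiteBare a h (fun y k l => (193 / 125) * ((3 / 4 : ℝ) / 4) * fpChi ((81 / 20 * a) ^ 2) ((27 / 5 * a) ^ 2) (y - fun k => hcpSite a h p k) ^ 2 *
          (fpSq (y - fun k => hcpSite a h p k))⁻¹ ^ 4 * (if k = l then 1 else 0)) (fun _ => z) q ≤
      (193 / 125) * ((3 / 4 : ℝ) / 4) * fpSq z * ((r ^ 2)⁻¹) ^ 4 *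
        (√3 * a ^ 2 * h / 2 + 2 / 3 * a ^ 3 * h / r + 10 * a ^ 2 / r ^ 2 * (√3 * a ^ 2 * h / 2) +
          18 / (r ^ 2) ^ 2 * (6 * a * r + 9 / 4 * a ^ 2) * ((√3 * a ^ 2 * h / 2) * (2 / 9 * a ^ 2 + h ^ 2 / 6))) := by
  have hr0 : 0 < r := lt_of_lt_of_le (by positivity) hr
  set d : Fin 3 → ℝ := fun k => hcpSite a h q k - hcpSite a h p k with hd_def
  set K : ℝ := (193 / 125) * ((3 / 4 : ℝ) / 4) * fpSq z * ((r ^ 2)⁻¹) ^ 4 with hK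
  have hK0 : 0 ≤ K := by have := fpSq_nonneg z; positivity
  set c₁ : Fin 3 → ℝ := fun k => (K * (-(8 / r ^ 2))) * d k with hc₁
  set C : Fin 3 → Fin 3 → ℝ := fun k l => (K * (72 / (r ^ 2) ^ 2)) * (d k * d l) +
    (K * (18 / (r ^ 2) ^ 2 * (6 * a * r + 9 / 4 * a ^ 2))) * (if k = l then 1 else 0) with hC
  rw [p1SiteBare_const_eq_star]
  -- Step 1: pointwise bound on the star cells and monotonicity
  have hS1 : (0 : ℝ) < (81 / 20 * a) ^ 2 := by positivity
  have hS12 : (81 / 20 * a) ^ 2 < (27 / 5 * a) ^ 2 := by nlinarith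
  have hf : Continuous fun y : Fin 3 → ℝ => p1Quad3 (fun k l => (193 / 125) * ((3 / 4 : ℝ) / 4) *
      fpChi ((81 / 20 * a) ^ 2) ((27 / 5 * a) ^ 2) (y - fun k => hcpSite a h p k) ^ 2 *
      (fpSq (y - fun k => hcpSite a h p k))⁻¹ ^ 4 * (if k = l then 1 else 0)) z := by
    refine continuous_p1Quad3_of_continuous (fun k l => ?_) (fun k => continuous_const)
    exact (continuous_credWeight hS1 hS12 ((193 / 125) * ((3 / 4 : ℝ) / 4)) k l).comp (by fun_prop)
  have hg : Continuous fun y : Fin 3 → ℝ => K + fpDot c₁ (fun k => y k - hcpSite a h q k) + p1Quad3 C (fun k => y k - hcpSite a h q k) := by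
    simp only [fpDot, p1Quad3_eq, hc₁, hC]
    fun_prop
  have hmono := p1Star_setIntegral_mono ha hh q hf hg (fun o ho π m hv y hy => by
    set e : Fin 3 → ℝ := fun k => y k - hcpSite a h q k with he_def
    have he : fpSq e ≤ 9 / 4 * a ^ 2 := (fpSq_sub_le_of_mem_starCell ha.ne' hh.ne' q ho hv hy).trans (by nlinarith)
    have hx : (y - fun k => hcpSite a h p k) = d + e := by funext k; simp [hd_def, he_def]
    rw [p1Quad3_credWeight, hx]
    have hχ := fpChi_sq_le_one ((81 / 20 * a) ^ 2) ((27 / 5 * a) ^ 2) (d + e)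
    have hpt := cred_pointwise_le ha.le hr hr0 hd he
    have hZ : 0 ≤ z 0 ^ 2 + z 1 ^ 2 + z 2 ^ 2 := by positivity
    have hS0 : 0 ≤ (fpSq (d + e))⁻¹ ^ 4 := by have := fpSq_nonneg (d + e); positivity
    have hid : K + fpDot c₁ e + p1Quad3 C e = (193 / 125) * ((3 / 4 : ℝ) / 4) * (((r ^ 2)⁻¹) ^ 4 *
        (1 - 8 / r ^ 2 * fpDot d e + 72 / (r ^ 2) ^ 2 * fpDot d e ^ 2 + 18 / (r ^ 2) ^ 2 * (6 * a * r + 9 / 4 * a ^ 2) * fpSq e)) *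
        (z 0 ^ 2 + z 1 ^ 2 + z 2 ^ 2) := by
      simp only [hK, hc₁, hC, fpDot, p1Quad3_eq, fpSq]
      simp only [Fin.isValue, ↓reduceIte, Fin.zero_eq_one_iff, Fin.reduceEq, one_ne_zero]
      norm_num
      ring
    rw [hid]
    calc (193 / 125) * ((3 / 4 : ℝ) / 4) * fpChi ((81 / 20 * a) ^ 2) ((27 / 5 * a) ^ 2) (d + e) ^ 2 * (fpSq (d + e))⁻¹ ^ 4 *
          (z 0 ^ 2 + z 1 ^ 2 + z 2 ^ 2)
        ≤ (193 / 125) * ((3 / 4 : ℝ) / 4) * 1 * (fpSq (d + e))⁻¹ ^ 4 * (z 0 ^ 2 + z 1 ^ 2 + z 2 ^ 2) := by gcongr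
      _ ≤ (193 / 125) * ((3 / 4 : ℝ) / 4) * (((r ^ 2)⁻¹) ^ 4 *
        (1 - 8 / r ^ 2 * fpDot d e + 72 / (r ^ 2) ^ 2 * fpDot d e ^ 2 + 18 / (r ^ 2) ^ 2 * (6 * a * r + 9 / 4 * a ^ 2) * fpSq e)) *
        (z 0 ^ 2 + z 1 ^ 2 + z 2 ^ 2) := by rw [mul_one]; gcongr)
  refine hmono.trans ?_
  -- Step 2: evaluate the polynomial star integral
  rw [p1Star_setIntegral_poly ha hh q K c₁ C]
  -- Step 3: bound the three pieces
  have hV0 : 0 ≤ √3 * a ^ 2 * h / 2 := by positivity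
  have h1 : ∑ k : Fin 3, c₁ k * (√3 * a ^ 2 * h / 240 *
      (if Even q.1 then (![10 * a, -(10 * √3 / 3) * a, 0] : Fin 3 → ℝ) k else (![-(10 * a), 10 * √3 / 3 * a, 0] : Fin 3 → ℝ) k)) ≤
      K * (2 / 3 * a ^ 3 * h / r) := by
    rw [hc₁, sum3_const_mul]
    have ht := abs_tilt_le ha.le hh.le q hr0.le hd
    have ht' := (abs_le.1 ht).1
    have hm : K * (8 / r ^ 2) * -(∑ k : Fin 3, d k * (√3 * a ^ 2 * h / 240 *
        (if Even q.1 then (![10 * a, -(10 * √3 / 3) * a, 0] : Fin 3 → ℝ) k else (![-(10 * a), 10 * √3 / 3 * a, 0] : Fin 3 → ℝ) k))) ≤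
        K * (8 / r ^ 2) * (a ^ 3 * h / 12 * r) :=
      mul_le_mul_of_nonneg_left (by linarith [ht']) (by positivity)
    have he : K * (8 / r ^ 2) * (a ^ 3 * h / 12 * r) = K * (2 / 3 * a ^ 3 * h / r) := by
      field_simp
      ring
    linarith [hm, he]
  have h2 : ∑ k : Fin 3, ∑ l : Fin 3, C k l * (√3 * a ^ 2 * h / 2 *
      (!![a ^ 2 / 8, -(√3 / 72) * a ^ 2, 0; -(√3 / 72) * a ^ 2, 7 * a ^ 2 / 72, 0; 0, 0, h ^ 2 / 6] : Matrix (Fin 3) (Fin 3) ℝ) k l) ≤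
      K * (10 * a ^ 2 / r ^ 2 * (√3 * a ^ 2 * h / 2) +
        18 / (r ^ 2) ^ 2 * (6 * a * r + 9 / 4 * a ^ 2) * ((√3 * a ^ 2 * h / 2) * (2 / 9 * a ^ 2 + h ^ 2 / 6))) := by
    rw [hC, sum33_add_const_mul, secondMoment_trace_eq]
    have hq := secondMoment_quad_le hh.le hha d
    rw [hd] at hq
    have hq' : K * (72 / (r ^ 2) ^ 2) * ∑ k : Fin 3, ∑ l : Fin 3, (d k * d l) * (√3 * a ^ 2 * h / 2 *
        (!![a ^ 2 / 8, -(√3 / 72) * a ^ 2, 0; -(√3 / 72) * a ^ 2, 7 * a ^ 2 / 72, 0; 0, 0, h ^ 2 / 6] : Matrix (Fin 3) (Fin 3) ℝ) k l) ≤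
        K * (72 / (r ^ 2) ^ 2) * (√3 * a ^ 2 * h / 2 * (5 * a ^ 2 / 36) * r ^ 2) :=
      mul_le_mul_of_nonneg_left hq (by positivity)
    have he : K * (72 / (r ^ 2) ^ 2) * (√3 * a ^ 2 * h / 2 * (5 * a ^ 2 / 36) * r ^ 2) +
        K * (18 / (r ^ 2) ^ 2 * (6 * a * r + 9 / 4 * a ^ 2)) * (1 * (√3 * a ^ 2 * h / 2) * (2 / 9 * a ^ 2 + h ^ 2 / 6)) =
        K * (10 * a ^ 2 / r ^ 2 * (√3 * a ^ 2 * h / 2) +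
          18 / (r ^ 2) ^ 2 * (6 * a * r + 9 / 4 * a ^ 2) * ((√3 * a ^ 2 * h / 2) * (2 / 9 * a ^ 2 + h ^ 2 / 6))) := by
      field_simp
      ring
    linarith [hq', he]
  have hdist : K * (√3 * a ^ 2 * h / 2 + 2 / 3 * a ^ 3 * h / r + 10 * a ^ 2 / r ^ 2 * (√3 * a ^ 2 * h / 2) +
      18 / (r ^ 2) ^ 2 * (6 * a * r + 9 / 4 * a ^ 2) * ((√3 * a ^ 2 * h / 2) * (2 / 9 * a ^ 2 + h ^ 2 / 6))) =
      K * (√3 * a ^ 2 * h / 2) + K * (2 / 3 * a ^ 3 * h / r) + K * (10 * a ^ 2 / r ^ 2 * (√3 * a ^ 2 * h / 2) +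
        18 / (r ^ 2) ^ 2 * (6 * a * r + 9 / 4 * a ^ 2) * ((√3 * a ^ 2 * h / 2) * (2 / 9 * a ^ 2 + h ^ 2 / 6))) := by ring
  linarith [h1, h2, hdist]

/-! ## The radial-deficit share of a far site, integrated over its star -/
set_option maxHeartbeats 400000 in
/-- **RADIAL SHARE OF A FAR SITE (lower bound)**: for `‖y_q − y_p‖ = r ≥ 20a` (and `h² ≤ 5a²/6`), with `P = ⟪d,z⟫`, `ζ = |z|`,
`Bare_rad,q(z) ≥ κ(19/8)r⁻¹⁰·[P²V − (135/4)(a³/r)|z|²V − (a³h/6)|P|ζ − (5/6)(a³h/r)P² − 20Vσ'|P|ζ/r − 5VτP²/r²]`,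
`V = √3a²h/2`, `τ = (2/9)a² + h²/6`, `σ' = (1/8 + √3/36 + 7/72)a² + h²/6`.  NOT a proof of H12⋆, NOT summit progress. -/
theorem radStar_ge {a h : ℝ} (ha : 0 < a) (hh : 0 < h) (hha : h ^ 2 ≤ 5 / 6 * a ^ 2) (p q : ℤ × ℤ × ℤ) {r : ℝ}
    (hr : 20 * a ≤ r) (hd : fpSq (fun k => hcpSite a h q k - hcpSite a h p k) = r ^ 2) (z : Fin 3 → ℝ) {ζ : ℝ}
    (hζ : 0 ≤ ζ) (hz : fpSq z = ζ ^ 2) :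
    (193 / 125) * ((7 * (5 / 4 : ℝ) + 3 / 4) / 4) * ((r ^ 2)⁻¹) ^ 5 *
        (fpDot (fun k => hcpSite a h q k - hcpSite a h p k) z ^ 2 * (√3 * a ^ 2 * h / 2) -
          135 / 4 * (a ^ 3 / r) * fpSq z * (√3 * a ^ 2 * h / 2) -
          a ^ 3 * h / 6 * |fpDot (fun k => hcpSite a h q k - hcpSite a h p k) z| * ζ -
          5 / 6 * (a ^ 3 * h / r) * fpDot (fun k => hcpSite a h q k - hcpSite a h p k) z ^ 2 -
          20 * (√3 * a ^ 2 * h / 2) * ((1 / 8 + √3 / 36 + 7 / 72) * a ^ 2 + h ^ 2 / 6) *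
            |fpDot (fun k => hcpSite a h q k - hcpSite a h p k) z| * ζ / r -
          5 * (√3 * a ^ 2 * h / 2) * (2 / 9 * a ^ 2 + h ^ 2 / 6) * fpDot (fun k => hcpSite a h q k - hcpSite a h p k) z ^ 2 / r ^ 2) ≤
      p1SiteBare a h (fun y k l => (193 / 125) * ((7 * (5 / 4 : ℝ) + 3 / 4) / 4) *
          fpChi ((81 / 20 * a) ^ 2) ((27 / 5 * a) ^ 2) (y - fun k => hcpSite a h p k) ^ 2 *
          (fpSq (y - fun k => hcpSite a h p k))⁻¹ ^ 5 * ((y - fun k => hcpSite a h p k) k * (y - fun k => hcpSite a h p k) l))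
        (fun _ => z) q := by
  have hr0 : 0 < r := lt_of_lt_of_le (by positivity) hr
  set d : Fin 3 → ℝ := fun k => hcpSite a h q k - hcpSite a h p k with hd_def
  set K : ℝ := (193 / 125) * ((7 * (5 / 4 : ℝ) + 3 / 4) / 4) * ((r ^ 2)⁻¹) ^ 5 with hK
  have hK0 : 0 ≤ K := by positivity
  set P : ℝ := fpDot d z with hP
  set c₀ : ℝ := K * (P ^ 2 - 135 / 4 * (a ^ 3 / r) * fpSq z) with hc₀
  set c₁ : Fin 3 → ℝ := fun k => (K * (2 * P)) * z k + (K * (-(10 / r ^ 2 * P ^ 2))) * d k with hc₁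
  set C : Fin 3 → Fin 3 → ℝ := fun k l => (K * (-(20 / r ^ 2 * P))) * (z k * d l) +
    (K * (-(5 / r ^ 2 * P ^ 2))) * (if k = l then 1 else 0) with hC
  rw [p1SiteBare_const_eq_star]
  -- Step 1: pointwise bound on the star cells and monotonicity
  have hS1 : (0 : ℝ) < (81 / 20 * a) ^ 2 := by positivity
  have hS12 : (81 / 20 * a) ^ 2 < (27 / 5 * a) ^ 2 := by nlinarith
  have hf : Continuous fun y : Fin 3 → ℝ => p1Quad3 (fun k l => (193 / 125) * ((7 * (5 / 4 : ℝ) + 3 / 4) / 4) *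
      fpChi ((81 / 20 * a) ^ 2) ((27 / 5 * a) ^ 2) (y - fun k => hcpSite a h p k) ^ 2 *
      (fpSq (y - fun k => hcpSite a h p k))⁻¹ ^ 5 * ((y - fun k => hcpSite a h p k) k * (y - fun k => hcpSite a h p k) l)) z := by
    refine continuous_p1Quad3_of_continuous (fun k l => ?_) (fun k => continuous_const)
    exact (continuous_radWeight hS1 hS12 ((193 / 125) * ((7 * (5 / 4 : ℝ) + 3 / 4) / 4)) k l).comp (by fun_prop)
  have hg : Continuous fun y : Fin 3 → ℝ => c₀ + fpDot c₁ (fun k => y k - hcpSite a h q k) + p1Quad3 C (fun k => y k - hcpSite a h q k) := by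
    simp only [fpDot, p1Quad3_eq, hc₁, hC]
    fun_prop
  have hmono := p1Star_setIntegral_mono ha hh q hg hf (fun o ho π m hv y hy => by
    set e : Fin 3 → ℝ := fun k => y k - hcpSite a h q k with he_def
    have he : fpSq e ≤ 9 / 4 * a ^ 2 := (fpSq_sub_le_of_mem_starCell ha.ne' hh.ne' q ho hv hy).trans (by nlinarith)
    have hx : (y - fun k => hcpSite a h p k) = d + e := by funext k; simp [hd_def, he_def]
    rw [p1Quad3_radWeight, hx]
    obtain ⟨_, _, hS3⟩ := fpSq_add_ge_of_star ha.le hr hd he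
    rw [fpChi_eq_one hS12 hS3, one_pow, mul_one]
    have hpt := rad_pointwise_ge (z := z) ha.le hr hr0 hd he
    have hid : c₀ + fpDot c₁ e + p1Quad3 C e = (193 / 125) * ((7 * (5 / 4 : ℝ) + 3 / 4) / 4) * (((r ^ 2)⁻¹) ^ 5 *
        (fpDot d z ^ 2 + 2 * fpDot d z * fpDot z e - 10 / r ^ 2 * fpDot d z ^ 2 * fpDot d e -
          20 / r ^ 2 * fpDot d z * (fpDot z e * fpDot d e) - 5 / r ^ 2 * fpDot d z ^ 2 * fpSq e -
          135 / 4 * (a ^ 3 / r) * fpSq z)) := by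
      simp only [hK, hc₀, hc₁, hC, hP, fpDot, p1Quad3_eq, fpSq]
      simp only [Fin.isValue, ↓reduceIte, Fin.zero_eq_one_iff, Fin.reduceEq, one_ne_zero]
      norm_num
      ring
    rw [hid]
    exact le_of_le_of_eq (mul_le_mul_of_nonneg_left hpt (by norm_num)) (by ring))
  refine le_trans ?_ hmono
  -- Step 2: evaluate the polynomial star integral
  rw [p1Star_setIntegral_poly ha hh q c₀ c₁ C]
  -- Step 3: bound the pieces from below (`P·Σ ≥ −|P|·B` whenever `|Σ| ≤ B`)
  have hPS : ∀ {S B c : ℝ}, |S| ≤ B → 0 ≤ c → -(c * |P| * B) ≤ c * P * S ∧ c * P * S ≤ c * |P| * B := fun {S B c} hS hc => by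
    have h1' : |P * S| ≤ |P| * B := by rw [abs_mul]; exact mul_le_mul_of_nonneg_left hS (abs_nonneg P)
    have h2' := neg_abs_le (P * S)
    have h3' := le_abs_self (P * S)
    have := mul_le_mul_of_nonneg_left (show -(|P| * B) ≤ P * S by linarith) hc
    have := mul_le_mul_of_nonneg_left (show P * S ≤ |P| * B by linarith) hc
    constructor <;> linarith
  have h1 : -(K * 2 * |P| * (a ^ 3 * h / 12 * ζ)) + K * (-(10 / r ^ 2 * P ^ 2)) * (a ^ 3 * h / 12 * r) ≤
      ∑ k : Fin 3, c₁ k * (√3 * a ^ 2 * h / 240 *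
        (if Even q.1 then (![10 * a, -(10 * √3 / 3) * a, 0] : Fin 3 → ℝ) k else (![-(10 * a), 10 * √3 / 3 * a, 0] : Fin 3 → ℝ) k)) := by
    rw [hc₁, sum3_add_const_mul]
    have htz := abs_tilt_le ha.le hh.le q hζ hz
    have htd := abs_le.1 (abs_tilt_le ha.le hh.le q hr0.le hd)
    have hB : K * (-(10 / r ^ 2 * P ^ 2)) * (a ^ 3 * h / 12 * r) ≤ K * (-(10 / r ^ 2 * P ^ 2)) * ∑ k : Fin 3, d k *
        (√3 * a ^ 2 * h / 240 * (if Even q.1 then (![10 * a, -(10 * √3 / 3) * a, 0] : Fin 3 → ℝ) k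
          else (![-(10 * a), 10 * √3 / 3 * a, 0] : Fin 3 → ℝ) k)) := by
      have h0 : 0 ≤ K * (10 / r ^ 2 * P ^ 2) := by positivity
      have := mul_le_mul_of_nonneg_left htd.2 h0
      linarith
    have hA := (hPS htz (show 0 ≤ K * 2 by positivity)).1
    linarith
  have h2 : -(K * (20 / r ^ 2) * |P| * ((√3 * a ^ 2 * h / 2) * ((1 / 8 + √3 / 36 + 7 / 72) * a ^ 2 + h ^ 2 / 6) * ζ * r)) +
      K * (-(5 / r ^ 2 * P ^ 2)) * (1 * (√3 * a ^ 2 * h / 2) * (2 / 9 * a ^ 2 + h ^ 2 / 6)) ≤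
      ∑ k : Fin 3, ∑ l : Fin 3, C k l * (√3 * a ^ 2 * h / 2 *
        (!![a ^ 2 / 8, -(√3 / 72) * a ^ 2, 0; -(√3 / 72) * a ^ 2, 7 * a ^ 2 / 72, 0; 0, 0, h ^ 2 / 6] : Matrix (Fin 3) (Fin 3) ℝ) k l) := by
    rw [hC, sum33_add_const_mul, secondMoment_trace_eq]
    have hm := abs_secondMoment_mixed_le (a := a) hh.le hζ hr0.le hz hd
    have hA := (hPS hm (show 0 ≤ K * (20 / r ^ 2) by positivity)).2
    linarith
  -- Step 4: collect
  have hid2 : K * (P ^ 2 * (√3 * a ^ 2 * h / 2) - 135 / 4 * (a ^ 3 / r) * fpSq z * (√3 * a ^ 2 * h / 2) -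
        a ^ 3 * h / 6 * |P| * ζ - 5 / 6 * (a ^ 3 * h / r) * P ^ 2 -
        20 * (√3 * a ^ 2 * h / 2) * ((1 / 8 + √3 / 36 + 7 / 72) * a ^ 2 + h ^ 2 / 6) * |P| * ζ / r -
        5 * (√3 * a ^ 2 * h / 2) * (2 / 9 * a ^ 2 + h ^ 2 / 6) * P ^ 2 / r ^ 2) =
      c₀ * (√3 * a ^ 2 * h / 2) +
        (-(K * 2 * |P| * (a ^ 3 * h / 12 * ζ)) + K * (-(10 / r ^ 2 * P ^ 2)) * (a ^ 3 * h / 12 * r)) +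
        (-(K * (20 / r ^ 2) * |P| * ((√3 * a ^ 2 * h / 2) * ((1 / 8 + √3 / 36 + 7 / 72) * a ^ 2 + h ^ 2 / 6) * ζ * r)) +
          K * (-(5 / r ^ 2 * P ^ 2)) * (1 * (√3 * a ^ 2 * h / 2) * (2 / 9 * a ^ 2 + h ^ 2 / 6))) := by
    rw [hc₀]
    field_simp
    ring
  linarith [hid2, h1, h2]

end Summit.AtomisticToContinuum.Crystallization.Theorems.StrictSplittingRuleBirth

end
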